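import Summits.QuantumFields.YangMills.Theorems.UnitScaleTiltProp7SectET3LandauOpRowsEtaT3
import Summits.QuantumFields.YangMills.Theorems.UnitScaleTiltProp7Size19Orders01T3
import Summits.QuantumFields.YangMills.Theorems.UnitScaleTiltProp7ChartDatumSplit
import Summits.QuantumFields.YangMills.Theorems.UnitScaleTiltProp7HDsolAtRecordOfRows
import HarnessLib

/-!
# Route `UnitScaleTilt`, crux «MinimiserStabilityRegPr» (stmt-QuantumFields-19200, stub EX `stub_existenceMinimalOrbit`), node N06(d = 3), route (α) —
# **«HDSOL-TWO-SLOT» (EX namer ★w2-19200 g7 SLOT WORD 2026-08-28, cure of display defect №8 `hmult`, ★★OWNER RULING g28-№9 cure (a)): THE `hΔsol` JUNCTION WITH THE LETTERS'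
# SLOT `ΔL` AND THE OPERATOR SLOT `Δx` DECOUPLED** — ✓`Prop7HDsolAtRecordOfRowsEta.hΔsol_at_record_of_rowsEta` (★px16 g2, p676474) VERBATIM except: (i) the letters `𝒢f := frakGfR … ΔL`,
# `H₁f := H1f … ΔL` (in `norm_G norm_H₁ heq`, in the field `ιA₁ + ι(H₁B̃)` of `h128` and of the conclusion) read a slot `ΔL` INDEPENDENT of the slot `Δx` of the class `hp`, of the four
# operator rows `hOpC h137 hOp139 hOp349` and of the operator in `h128`; (ii) the solution's slice rows `hLan hQY` are NOT hypotheses any more — they are THEOREMS from the class `hpL` and the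
# two Landau guards `hkillL horthL` of `ΔL` (✓`Prop7HessRowOfEq111.RS_DstarL2_sol` ∕ ✓`Qk_sol` on the `L²` reading ✓`toL2_iota_eq111` of (111)), guards which are THEOREMS at `ΔL := DeltaOnePJ`
# (✓`DeltaOneP_kills_NS`, ✓`inner_DL2_DeltaOneP_eq_zero`, `0 ≤ a`) and FALSE at `Δ^η`.
#
# WHY TWO SLOTS (the namer's LOCATE, print [Balaban1985Variational] pp.293–298 + [Balaban1985BackgroundPropagators] pp.419–425).  Print's letters `G₁ H₁ 𝔊 = G₁𝔓₁*` and the equation (111)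
# live at `Δ₁` = the operator of the form (79) = `Pᵀ(Δ^η + T_J)P` (gauge-invariant extension (3.119) + the J-term (3.127)–(3.128)), where (3.124) `RD*G₁Q* = 0`, `QG₁DR = 0` hold EXACTLY —
# the tree's `DeltaOnePJ` (✓p668391).  Print's second-order route (127)–(136) for the solution `A₁′ = A₀ + H₀B` uses INSTEAD `Δ_a = Δ + DRD* + Q*aQ` with `Δ` the Hessian of the TRUE chart
# action («the functional (74), with the operator Δ instead of Δ_π», p.297), `G = Δ_a⁻¹` ([5] Thm 3.3), `H₀ = GQ*(QGQ*)⁻¹` (129), `P₀` (131) — NO `𝔓`, NO (3.124): the gauge part is carried by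
# (127), the criticality of the TRUE action on all of `ker Q`, i.e. (128) `J + Δ_aA₁′ + (δ∕δA′)V = Q*μ`.  With the display's ONE opaque `W` (lit's `W80 … (Δπ := Δ̂^η)`, the derivative of the
# (80)-remainder of the TRUE action), lit (84) ✓`B11Eq81ExpansionZpow.hasDerivAt_actionZ_chartRay_real` reads `∇S(A′)·δ′ = ⟨δ′, J⟩ + ⟨δ′, Δ₁A′⟩ + ⟨δ′, W A′⟩` with `Δ₁ = Δ^η + T_J`
# (★px21 ✓p675218 rows `h79 hΔ₁` at `DeltaEtaSlot + TJSlotP`), so (128) holds EXACTLY at `Δx := Δ^η + T_Jᴾ` and at no other slot (at `Δ^η`: off by `T_JA′ ∉ range Q*`; at `Δ₁ᴾ`: off by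
# the `R_S`-multiplier `D R_S ν` of the gauge-variant functional (74), (105)–(109)); while (111) with the same `W` holds EXACTLY at `ΔL := Δ₁ᴾ` (`𝔊₁` kills `range Q*` and `range D R_S`,
# [5] p.425 «RD*G₁DR = R»).  Re-lettering `𝒢f∕H₁f` to `Δ^η` instead would make (102)∕(102)L∕(129)L and (111) itself non-print ((3.124) fails for the naive `Δ`, [5] (3.117) «almost
# invariance»; `𝔊_η = G P₀* − G DR_SD*G ≠` print's (133)).  Hence: letters at `ΔL`, operator at `Δx`, one theorem generic in both.
#
# Cell `ym3-torus` (HUMAN RULING D-0037, YM ladder rung R3 — YM₃ on T³, NOT d = 4, NOT Clay; YM gap NOT proved), width seat `ym-ust-19200-w2` (gen 7; EX knit lineage + EX letter namer).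
# THEOREMS ONLY (0 `def`, 0 `sorry`); `--supports stmt-QuantumFields-19200 --as helper`, count-neutral; nothing of the stub ∕ the crux is claimed.

WHAT IS PROVED (ns `…Theorems.Prop7HDsolAtRecordOfRowsTwoSlot`).  ★★★`hΔsol_at_record_of_rows_twoSlot` — hypotheses: the `hΔsol` prefix (`hreg hclose hwin hρ1`), the class + guards at `ΔL`
(`hpL hkillL horthL`), the class at `Δx` (`hp`), letter rows `norm_G quad norm_H₁` (at `ΔL`), Prop. 6 windows `h1 h2 h3`, the four operator rows at `Δx`, the displayed solution `A₁ hA₁ heq` (at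
`ΔL`), `(μ) h128` (operator `Δx`, field at `ΔL`); conclusion = (136)+(140) for `ιA₁ + ι(H₁B̃)` at `MΔ·ρ·η²`, `MΔ := (1 + 25C₄B₀²) + cC(1 + 25C₄B₀²) + 2c₁₃₇ + 5k₁₃₉B₀ + 140B₀ + 5k₃₄₉B₀ + 20B₀`,
`ρ = L³·3L·ε₁` — the SAME text and constant as ✓p676474 ∕ ✓p669325.  Proof = ✓p676474's body + three lines (`hY hLan hQY`) from ✓p669325's, one call of ★px5's ✓`secondOrder_of_eq128_opRowsEta_rho` at `Δx`.
HONEST SCOPE.  By-name composition; the operator rows, `hpL hp`, `h128` (with `μ`), `heq`, `norm_G quad norm_H₁` stay DISPLAYED at the family level (the EX namer's family door is the sequel);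
not a proof of the stub; nothing continuum ∕ OS ∕ mass-gap ∕ Clay.

References: T. Bałaban, CMP **102** (1985) 277–309 [Balaban1985Variational] ((19)–(20) p.281, (28) p.282, (45) p.285, (74) p.289, (79)–(84) p.290, (97) p.292, (102) p.293, (105)–(111) p.294,
Prop. 6 (116) p.295, (127)–(140) pp.297–299); CMP **99** (1985) 389–434 [Balaban1985BackgroundPropagators] ((3.12) p.392, (3.26) p.395, Thm 3.3 p.396, (3.19) p.393, (3.49) p.399,
(3.117)–(3.128) pp.419–421, (3.137) p.423, (3.147) p.425, (3.153) p.426).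
-/

set_option autoImplicit false

noncomputable section

open scoped InnerProductSpace ComplexConjugate Matrix.Norms.L2Operator

namespace Summit.QuantumFields.YangMills.Theorems.Prop7HDsolAtRecordOfRowsTwoSlot

open Literature.MathematicalPhysics.QuantumFieldTheory.Balaban1983to89
open Literature.MathematicalPhysics.QuantumFieldTheory.Balaban1983to89.T3ContinuumYM3Torus
open Literature.MathematicalPhysics.QuantumFieldTheory.Balaban1983to89.T3PrintedRegularMinimiser (RegPr)
open Literature.MathematicalPhysics.QuantumFieldTheory.Balaban1983to89.T3UnitLawDensityEML (ℰp)
open Literature.MathematicalPhysics.QuantumFieldTheory.Balaban1983to89.T3TiltDescent (descendTo)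
open T3SectALandauChart (eta eta_pos covCodiffCurlT covLapFormT bgUnits CloseAvg)
open B9SectCLatticeCarrier (Bond)
open B9Eq311L2Pairing (WL2)
open B11Eq115Space (NegSize NegSup Space115 JetSup levWeight)
open B11Eq111FrakG (nabla115)
open B11Eq103H1Complex (SiteL2K BondL2K funEquiv funEquiv_symm_apply)
open B11Eq98CurrentSlot (Jcur norm_Jcur_le)
open B13Contraction113 (QuadAnalytic)
open MatrixLog (mlog)
open Summit.QuantumFields.YangMills.Theorems.Prop7SectET3Transport (periodsT3 bondEquiv bgOfCfg isUnitaryBg_bgOfCfg levWeight_const_eq_one norm_negSize_const_eq)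
open Summit.QuantumFields.YangMills.Theorems.Prop7SectET3HilbertLetters (W₂ frobEquiv toL2 toL2S toL2B DL2 DstarL2 toL2_symm_apply)
open Summit.QuantumFields.YangMills.Theorems.Prop7SectET3GaugeProjector (NS RS)
open Summit.QuantumFields.YangMills.Theorems.Prop7SectET3WilsonHessian (DeltaEta)
open Summit.QuantumFields.YangMills.Theorems.Prop7SectET3CurvedPropagators
open Summit.QuantumFields.YangMills.Theorems.Prop7SectET3DeltaPi
open Summit.QuantumFields.YangMills.Theorems.Prop7SectET3Objects (inU2cur_bgOfCfg_of_regPr prop6_bgOfCfg)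
open Summit.QuantumFields.YangMills.Theorems.Prop7Bound20SymLog (bound20_symLog_of_closeAvg)
open Summit.QuantumFields.YangMills.Theorems.Prop7HessRowOfEq111 (toL2_iota_eq111 RS_DstarL2_sol Qk_sol)
open Summit.QuantumFields.YangMills.Theorems.Prop7SectET3LandauOpRowsEta (secondOrder_of_eq128_opRowsEta_rho)
open Summit.QuantumFields.YangMills.Theorems.Prop7ChartDatumSplit (norm_jetRead_le)
open Summit.QuantumFields.YangMills.Theorems.Prop7HDsolAtRecordOfRows (toL2_symm_funEquiv_symm_apply norm_negSup_equiv_apply_le norm_jetRead_apply_le)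

variable {F : T3Family} {n K : ℕ} {c₀ : ℝ} [Fact (0 < c₀)]

/-! ## The junction: S9″'s `hΔsol` member text, letters at `ΔL`, operator rows and (128) at `Δx` -/

set_option maxHeartbeats 400000 in
-- HEARTBEAT rule (README): the statement carries the member's full letter terms (`frakGfR`, `H1f`, the slots `ΔL Δx`, `LinearMap.adjoint (Qk …)`, `KinvT`, `GT`); the junctions it calls
-- measured > 200k at elaboration (✓p669325 ∕ ✓p676474 carry the same budget line).
/-- ★★★ **`hΔsol` AT THE MEMBER, TWO SLOTS: letters (`𝒢f H₁f`, the solution `A₁` of (111), Prop. 6's sizes, the slice rows as THEOREMS) at `ΔL`; the class, the four operator rows and print's (128)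
at `Δx`** — ✓`hΔsol_at_record_of_rowsEta`'s text with `hLan hQY` DISCHARGED from `hpL hkillL horthL`; ONE call of ★px5's `secondOrder_of_eq128_opRowsEta_rho` at `Δx`,
at `cx := 1 + 25·C₄·B₀²`, `cb := 2`, `B₁ := 10·B₀`.
[cite: Balaban1985Variational, (127)–(136) pp.297–298, (140) p.299, (105)–(111) p.294, Prop. 6 p.295, (45) p.285, (102) p.293, (79)–(84) p.290, (19)–(20) p.281; Balaban1985BackgroundPropagators, (3.26) p.395, Thm 3.3 p.396, (3.19) p.393, (3.49) p.399, (3.124) p.420, (3.128) p.421, (3.147) p.425, (3.153) p.426] -/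
theorem hΔsol_at_record_of_rows_twoSlot (F : T3Family) (n K : ℕ) (h : n ≤ K) [Fact (0 < (F.L : ℝ))] [Fact (0 < ((F.L : ℝ)⁻¹) ^ (K - n))]
    {c₀ cB a : ℝ} [Fact (0 < c₀)] [Fact (0 < cB)]
    -- TWO HESSIAN SLOTS, BOTH GENERIC (EX namer w2 g7 slot word 2026-08-28): `ΔL` = the LETTERS' slot (print's `Δ₁`: `𝔊 = G₁𝔓₁*`, `H₁`, the solution `A₁` of (111),
    -- Prop. 6's sizes — S11: `DeltaOnePJ`), `Δx` = the OPERATOR slot of (128)∕(133) (print's `Δ_a = Δ + DRD* + Q*aQ` with `Δ` the TRUE Hessian of the chart action — S11: `Δ^η + T_Jᴾ`)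
    {ΔL Δx : GaugeField (F.P K) 0 (Matrix.specialUnitaryGroup (Fin 2) ℂ) → (BondL2K ℂ 3 (periodsT3 F K) c₀ W₂ →ₗ[ℂ] BondL2K ℂ 3 (periodsT3 F K) c₀ W₂)}
    (U₀ : GaugeField (F.P K) 0 (Matrix.specialUnitaryGroup (Fin 2) ℂ)) (V : GaugeField (F.P n) 0 (Matrix.specialUnitaryGroup (Fin 2) ℂ))
    -- the ONE opaque letter of the knit, print's `(δ∕δA′)V`, in S9's `Wf L i U₀` type
    (W : Space115 (F.L : ℝ) (((F.L : ℝ)⁻¹) ^ (K - n)) (fun _ : Bond 3 (periodsT3 F K) => K - n) (fun _ : Bond 3 (periodsT3 F K) × Fin 3 => K - n)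
            (nabla115 (((F.L : ℝ)⁻¹) ^ (K - n)) (bgOfCfg F K U₀)) →
          NegSize (F.L : ℝ) (((F.L : ℝ)⁻¹) ^ (K - n)) (fun _ : Bond 3 (periodsT3 F K) => K - n) 3 (Matrix (Fin 2) (Fin 2) ℂ))
    {B₀ C₄ a₃ r ε₁ cC c137 k139 k349 : ℝ} (hB₀ : 0 < B₀) (hC₄ : 0 < C₄) (hε₁ : 0 < ε₁)
    -- the prefix of S9's `hΔsol` at the member (+ the two numerals the knit derives from `ρ ≤ α ≤ 10⁻¹²L⁻³`)
    (hreg : RegPr F n K ((F.L : ℝ) ^ 3 * (3 * (F.L : ℝ)) * ε₁) U₀) (hclose : CloseAvg F n K h ((F.L : ℝ) ^ 3 * ε₁) V U₀)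
    (hwin : (F.L : ℝ) ^ 3 * ε₁ ≤ 1 / 2) (hρ1 : (F.L : ℝ) ^ 3 * (3 * (F.L : ℝ)) * ε₁ ≤ 1)
    -- the class AT THE LETTERS' SLOT `ΔL` with its two Landau guards ((3.124): `ΔL` kills and is range-orthogonal to `D N_S` — THEOREMS at `ΔL := DeltaOnePJ`, ✓`DeltaOneP_kills_NS` ∕
    -- ✓`inner_DL2_DeltaOneP_eq_zero`; they make the solution's slice rows (127)∕(102)L `R_S D*(ιA₁ + ιH₁B̃) = 0` and (45)∕(102) `Q_k(ιA₁ + ιH₁B̃) = B̃` THEOREMS via ✓`RS_DstarL2_sol` ∕ ✓`Qk_sol`)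
    (hpL : PosOnto F n K h c₀ cB a ΔL U₀)
    (hkillL : ∀ l ∈ NS F n K h c₀ cB U₀, ΔL U₀ (DL2 F n K c₀ U₀ l) = 0) (horthL : ∀ l ∈ NS F n K h c₀ cB U₀, ∀ w, ⟪DL2 F n K c₀ U₀ l, ΔL U₀ w⟫_ℂ = 0)
    -- the class AT THE OPERATOR SLOT `Δx` ([5] Thm 3.3 + (3.19): `Δ_a := Δx + DR_SD* + Q*aQ` positive and `Q_k` onto) — NO Landau guard on `Δx` (FALSE at `Δ^η` off critical backgrounds)
    (hp : PosOnto F n K h c₀ cB a Δx U₀)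
    -- the knit's letter rows AT THE LETTERS' SLOT `ΔL` (`norm_G` at `frakGfR …ΔL…`, `prop4`'s size clause at the opaque `W`, `norm_H₁` at `H1f …ΔL…`)
    (norm_G : ∀ f, ‖frakGfR F n K h c₀ cB a ΔL U₀ f‖ ≤ B₀ * ‖f‖) (quad : QuadAnalytic W C₄ a₃)
    (norm_H₁ : ∀ b, ‖H1f F n K h c₀ cB a ΔL U₀ b‖ ≤ B₀ * ‖b‖)
    -- Prop. 6's windows in its own letters (`ε₄ := r`, `C₁ := L³`, `B₃ := 3L`)
    (h1 : 2 * B₀ * (F.L : ℝ) ^ 3 * (3 * (F.L : ℝ)) * ε₁ ≤ r) (h2 : 4 * r ≤ a₃) (h3 : 16 * B₀ * C₄ * r ≤ 1)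
    -- THE FOUR DISPLAYED BACKGROUND-LEVEL ROWS AT THE OPERATOR SLOT `Δx` (★px5 g2 «OP-ROWS-127»∕«OPROWS-ETA» texts BYTE-EXACT: tube-only `hOpC′`, generic-`Y` `h137`,
    -- slot-defect `hOp139′` = `‖toL2⁻¹(Δ^η X − Δx X)‖ ≤ k139·s` on Landau `X` (at `Δx := Δ^η + T_Jᴾ` it is the sup-row of `T_Jᴾ`, [5] (3.137)), `hOp349`)
    (hOpC : ∀ (x : BondL2K ℂ 3 (periodsT3 F K) c₀ W₂) (bd : PBond (F.P K) 0),
      ‖(toL2 F K c₀).symm (LinearMap.adjoint (Qk F n K h c₀ cB U₀) (KinvT F n K h c₀ cB a Δx U₀ (Qk F n K h c₀ cB U₀ (GT F n K h c₀ cB a Δx U₀ x)))) bd‖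
        ≤ cC * ‖(toL2 F K c₀).symm x‖)
    (h137 : ∀ (Y : PBond (F.P n) 0 → Matrix (Fin 2) (Fin 2) ℂ) (b : PBond (F.P K) 0),
      ‖(toL2 F K c₀).symm (LinearMap.adjoint (Qk F n K h c₀ cB U₀) (KinvT F n K h c₀ cB a Δx U₀ (toL2B F n cB Y))
          - LinearMap.adjoint (Qk F n K h c₀ cB U₀) (((a : ℂ)) • toL2B F n cB Y)) b‖ ≤ c137 * ‖Y‖)
    (hOp139 : ∀ (X : PBond (F.P K) 0 → Matrix (Fin 2) (Fin 2) ℂ) (s : ℝ), RS F n K h c₀ cB U₀ (DstarL2 F n K c₀ U₀ (toL2 F K c₀ X)) = 0 → (∀ bd, ‖X bd‖ ≤ s) →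
      ∀ bd : PBond (F.P K) 0, ‖(toL2 F K c₀).symm (DeltaEta F n K c₀ U₀ (toL2 F K c₀ X) - Δx U₀ (toL2 F K c₀ X)) bd‖ ≤ k139 * s)
    (hOp349 : ∀ (X : PBond (F.P K) 0 → Matrix (Fin 2) (Fin 2) ℂ) (s : ℝ), (∀ bd, ‖X bd‖ ≤ s) → ∀ bd : PBond (F.P K) 0,
      ‖(toL2 F K c₀).symm (DL2 F n K c₀ U₀ (DstarL2 F n K c₀ U₀ (toL2 F K c₀ X) - RS F n K h c₀ cB U₀ (DstarL2 F n K c₀ U₀ (toL2 F K c₀ X)))) bd‖ ≤ k349 * s)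
    -- the displayed solution of (111) AT THE LETTERS' SLOT `ΔL` (S9″'s `A₁`, `‖A₁‖ < r L`, `heq` text)
    (A₁ : Space115 (F.L : ℝ) (((F.L : ℝ)⁻¹) ^ (K - n)) (fun _ : Bond 3 (periodsT3 F K) => K - n) (fun _ : Bond 3 (periodsT3 F K) × Fin 3 => K - n)
      (nabla115 (((F.L : ℝ)⁻¹) ^ (K - n)) (bgOfCfg F K U₀)))
    (hA₁ : ‖A₁‖ < r)
    (heq : A₁ + frakGfR F n K h c₀ cB a ΔL U₀ (Jcur (bgOfCfg F K U₀))
        + frakGfR F n K h c₀ cB a ΔL U₀ (W (A₁ + H1f F n K h c₀ cB a ΔL U₀ (fun c : PBond (F.P n) 0 =>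
          (-Complex.I) • mlog (((V c : Matrix.specialUnitaryGroup (Fin 2) ℂ) : Matrix (Fin 2) (Fin 2) ℂ)
            * star ((descendTo F ℰp n K h U₀ c : Matrix.specialUnitaryGroup (Fin 2) ℂ) : Matrix (Fin 2) (Fin 2) ℂ))))) = 0)
    -- PRINT's (128) FOR THE SOLUTION AT THE OPERATOR SLOT `Δx`, HILBERT FORM (★px21's display text, ★px5 v2's `h128`): `Δx(ιA₁ + ι(H₁B̃)) + (Ĵ + Ŵ) ∈ range Q_k†` with its multiplier `μ` —
    -- the derivative of the TRUE chart action vanishes on `ker Q` ([Balaban1985Variational] (127)–(128) p.297: «the functional (74), with the operator Δ instead of Δ_π»); the field is the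
    -- `ΔL`-lettered solution, the operator is `Δx`; NO `R_S`-multiplier.  INHABITED at `Δx := Δ^η + T_Jᴾ` with `W :=` lit's `W80 … (Δπ := Δ̂^η)` by lit (84) + (127) (★px21 «H128-OF-CRIT127»)
    (μ : WL2 ℂ (fun _ : PBond (F.P n) 0 => cB) W₂)
    (h128 : Δx U₀ (toL2 F K c₀ ((fun b : PBond (F.P K) 0 => JetSup.equiv _ _ _ A₁ (bondEquiv F K b))
        + (fun b : PBond (F.P K) 0 => JetSup.equiv _ _ _ (H1f F n K h c₀ cB a ΔL U₀ (fun c : PBond (F.P n) 0 =>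
          (-Complex.I) • mlog (((V c : Matrix.specialUnitaryGroup (Fin 2) ℂ) : Matrix (Fin 2) (Fin 2) ℂ)
            * star ((descendTo F ℰp n K h U₀ c : Matrix.specialUnitaryGroup (Fin 2) ℂ) : Matrix (Fin 2) (Fin 2) ℂ)))) (bondEquiv F K b))))
        + ((funEquiv frobEquiv (fun _ : Bond 3 (periodsT3 F K) => c₀)).symm
        (NegSup.equiv _ _ (Jcur (L := (F.L : ℝ)) (η := ((F.L : ℝ)⁻¹) ^ (K - n)) (lev₀ := fun _ : Bond 3 (periodsT3 F K) => K - n) (bgOfCfg F K U₀))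
          + NegSup.equiv _ _ (W (A₁ + H1f F n K h c₀ cB a ΔL U₀ (fun c : PBond (F.P n) 0 =>
          (-Complex.I) • mlog (((V c : Matrix.specialUnitaryGroup (Fin 2) ℂ) : Matrix (Fin 2) (Fin 2) ℂ)
            * star ((descendTo F ℰp n K h U₀ c : Matrix.specialUnitaryGroup (Fin 2) ℂ) : Matrix (Fin 2) (Fin 2) ℂ))))))) = LinearMap.adjoint (Qk F n K h c₀ cB U₀) μ) :
    (∀ (μ : Fin (F.P K).d) (x : Site (F.P K) 0),
        ‖covCodiffCurlT 1 (bgUnits F K U₀) ((fun b : PBond (F.P K) 0 => JetSup.equiv _ _ _ A₁ (bondEquiv F K b))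
        + (fun b : PBond (F.P K) 0 => JetSup.equiv _ _ _ (H1f F n K h c₀ cB a ΔL U₀ (fun c : PBond (F.P n) 0 =>
          (-Complex.I) • mlog (((V c : Matrix.specialUnitaryGroup (Fin 2) ℂ) : Matrix (Fin 2) (Fin 2) ℂ)
            * star ((descendTo F ℰp n K h U₀ c : Matrix.specialUnitaryGroup (Fin 2) ℂ) : Matrix (Fin 2) (Fin 2) ℂ)))) (bondEquiv F K b))) μ x‖
          ≤ ((1 + 25 * C₄ * B₀ ^ 2) + cC * (1 + 25 * C₄ * B₀ ^ 2) + c137 * 2 + k139 * (10 * B₀) / 2 + 14 * (10 * B₀) + k349 * (10 * B₀) / 2 + 2 * (10 * B₀))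
            * ((F.L : ℝ) ^ 3 * (3 * (F.L : ℝ)) * ε₁) * eta F n K ^ 2) ∧
      (∀ (ν : Fin (F.P K).d) (x : Site (F.P K) 0),
        ‖covLapFormT 1 (bgUnits F K U₀) ((fun b : PBond (F.P K) 0 => JetSup.equiv _ _ _ A₁ (bondEquiv F K b))
        + (fun b : PBond (F.P K) 0 => JetSup.equiv _ _ _ (H1f F n K h c₀ cB a ΔL U₀ (fun c : PBond (F.P n) 0 =>
          (-Complex.I) • mlog (((V c : Matrix.specialUnitaryGroup (Fin 2) ℂ) : Matrix (Fin 2) (Fin 2) ℂ)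
            * star ((descendTo F ℰp n K h U₀ c : Matrix.specialUnitaryGroup (Fin 2) ℂ) : Matrix (Fin 2) (Fin 2) ℂ)))) (bondEquiv F K b))) ν x‖
          ≤ ((1 + 25 * C₄ * B₀ ^ 2) + cC * (1 + 25 * C₄ * B₀ ^ 2) + c137 * 2 + k139 * (10 * B₀) / 2 + 14 * (10 * B₀) + k349 * (10 * B₀) / 2 + 2 * (10 * B₀))
            * ((F.L : ℝ) ^ 3 * (3 * (F.L : ℝ)) * ε₁) * eta F n K ^ 2) := by
  have hL : 0 < (F.L : ℝ) := Fact.out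
  set ρ : ℝ := (F.L : ℝ) ^ 3 * (3 * (F.L : ℝ)) * ε₁ with hρdef
  have hρ : 0 < ρ := by positivity
  -- the datum `B̃` and (20): `‖B̃‖ < 2·3L·(L³ε₁) = 2ρ`
  set Bt : PBond (F.P n) 0 → Matrix (Fin 2) (Fin 2) ℂ := fun c : PBond (F.P n) 0 =>
    (-Complex.I) • mlog (((V c : Matrix.specialUnitaryGroup (Fin 2) ℂ) : Matrix (Fin 2) (Fin 2) ℂ)
      * star ((descendTo F ℰp n K h U₀ c : Matrix.specialUnitaryGroup (Fin 2) ℂ) : Matrix (Fin 2) (Fin 2) ℂ)) with hBtdef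
  have hBt : ‖Bt‖ < 2 * ((3 : ℝ) * F.L) * ((F.L : ℝ) ^ 3 * ε₁) := bound20_symLog_of_closeAvg F h hε₁ hwin V U₀ hclose
  have h2ρ : 2 * ((3 : ℝ) * F.L) * ((F.L : ℝ) ^ 3 * ε₁) = 2 * ρ := by rw [hρdef]; ring
  have hBt' : ‖Bt‖ ≤ 2 * ρ := by rw [← h2ρ]; exact hBt.le
  -- the letters of record, abbreviated
  set 𝒢 := frakGfR F n K h c₀ cB a ΔL U₀ with h𝒢def
  set H₁ := H1f F n K h c₀ cB a ΔL U₀ with hH₁def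
  -- (103)∕(117): `‖H₁B̃‖ ≤ B₀‖B̃‖ < 2B₀ρ`
  have h𝔄 : ‖H₁ Bt‖ < 2 * ((3 : ℝ) * F.L) * B₀ * (F.L : ℝ) ^ 3 * ε₁ := by
    calc ‖H₁ Bt‖ ≤ B₀ * ‖Bt‖ := norm_H₁ Bt
      _ < B₀ * (2 * ((3 : ℝ) * F.L) * ((F.L : ℝ) ^ 3 * ε₁)) := mul_lt_mul_of_pos_left hBt hB₀
      _ = 2 * ((3 : ℝ) * F.L) * B₀ * (F.L : ℝ) ^ 3 * ε₁ := by ring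
  have h𝔄' : ‖H₁ Bt‖ ≤ 2 * B₀ * ρ := by
    calc ‖H₁ Bt‖ ≤ B₀ * ‖Bt‖ := norm_H₁ Bt
      _ ≤ B₀ * (2 * ρ) := mul_le_mul_of_nonneg_left hBt' hB₀.le
      _ = 2 * B₀ * ρ := by ring
  -- Prop. 6 (116): the displayed solution IS the unique one, of size `< 3B₀ρ`
  obtain ⟨A, -, -, hAsize, huniq⟩ := prop6_bgOfCfg F K n U₀ (𝒢 := 𝒢) (W := W) norm_G quad hB₀ hC₄ (by positivity : (0 : ℝ) < (F.L : ℝ) ^ 3)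
    (by positivity : (0 : ℝ) < 3 * (F.L : ℝ)) hε₁ (le_refl _) h1 h2 h3 hreg (𝔄 := H₁ Bt) h𝔄
  have hA₁eq : A₁ = A := huniq A₁ hA₁ heq
  have hA₁size : ‖A₁‖ < 3 * B₀ * ρ := by
    rw [hA₁eq]; calc ‖A‖ < 3 * B₀ * (F.L : ℝ) ^ 3 * (3 * (F.L : ℝ)) * ε₁ := hAsize
      _ = 3 * B₀ * ρ := by rw [hρdef]; ring
  have hsum : ‖A₁ + H₁ Bt‖ ≤ 5 * B₀ * ρ := by
    calc ‖A₁ + H₁ Bt‖ ≤ ‖A₁‖ + ‖H₁ Bt‖ := norm_add_le _ _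
      _ ≤ 3 * B₀ * ρ + 2 * B₀ * ρ := add_le_add hA₁size.le h𝔄'
      _ = 5 * B₀ * ρ := by ring
  -- (97): `‖W(A₁ + H₁B̃)‖ ≤ C₄‖A₁ + H₁B̃‖² ≤ 25C₄B₀²ρ` (the argument is in the ball `a₃` by the windows `h1 h2`)
  have hball : ‖A₁ + H₁ Bt‖ < a₃ := by
    have : 5 * B₀ * ρ < a₃ := by rw [hρdef]; nlinarith [mul_pos hB₀ hρ]
    exact hsum.trans_lt this
  have hW : ‖W (A₁ + H₁ Bt)‖ ≤ 25 * C₄ * B₀ ^ 2 * ρ := by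
    calc ‖W (A₁ + H₁ Bt)‖ ≤ C₄ * ‖A₁ + H₁ Bt‖ ^ 2 := quad.quad _ hball
      _ ≤ C₄ * (5 * B₀ * ρ) ^ 2 := mul_le_mul_of_nonneg_left (pow_le_pow_left₀ (norm_nonneg _) hsum 2) hC₄.le
      _ = 25 * C₄ * B₀ ^ 2 * ρ * ρ := by ring
      _ ≤ 25 * C₄ * B₀ ^ 2 * ρ * 1 := mul_le_mul_of_nonneg_left hρ1 (by positivity)
      _ = 25 * C₄ * B₀ ^ 2 * ρ := by ring
  -- (28): `‖J‖ ≤ C₁B₃ε₁ = ρ`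
  have hJ : ‖Jcur (L := (F.L : ℝ)) (η := ((F.L : ℝ)⁻¹) ^ (K - n)) (lev₀ := fun _ : Bond 3 (periodsT3 F K) => K - n) (bgOfCfg F K U₀)‖ ≤ ρ :=
    norm_Jcur_le (L := (F.L : ℝ)) (η := ((F.L : ℝ)⁻¹) ^ (K - n)) (lev₀ := fun _ : Bond 3 (periodsT3 F K) => K - n) _ (isUnitaryBg_bgOfCfg F K U₀)
      (by positivity) (inU2cur_bgOfCfg_of_regPr (F := F) (K := K) n U₀ hreg)
  -- the source `x = Ĵ + Ŵ` and the (115)-piece `Yf = ιA₁ + ι(H₁B̃)` as letters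
  set x : BondL2K ℂ 3 (periodsT3 F K) c₀ W₂ := (funEquiv frobEquiv (fun _ : Bond 3 (periodsT3 F K) => c₀)).symm
    (NegSup.equiv _ _ (Jcur (bgOfCfg F K U₀)) + NegSup.equiv _ _ (W (A₁ + H₁ Bt))) with hxdef
  set Yf : PBond (F.P K) 0 → Matrix (Fin 2) (Fin 2) ℂ := (fun b : PBond (F.P K) 0 => JetSup.equiv _ _ _ A₁ (bondEquiv F K b))
    + (fun b : PBond (F.P K) 0 => JetSup.equiv _ _ _ (H₁ Bt) (bondEquiv F K b)) with hYfdef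
  -- sizes: `nY := 5B₀ρ`, `sx := (1 + 25C₄B₀²)ρ`, `sb := 2ρ`
  have hYsup : ∀ bd, ‖Yf bd‖ ≤ 5 * B₀ * ρ := by
    intro bd
    rw [hYfdef, Pi.add_apply]
    calc ‖JetSup.equiv _ _ _ A₁ (bondEquiv F K bd) + JetSup.equiv _ _ _ (H₁ Bt) (bondEquiv F K bd)‖
        ≤ ‖JetSup.equiv _ _ _ A₁ (bondEquiv F K bd)‖ + ‖JetSup.equiv _ _ _ (H₁ Bt) (bondEquiv F K bd)‖ := norm_add_le _ _
      _ ≤ ‖A₁‖ + ‖H₁ Bt‖ := add_le_add (norm_jetRead_apply_le A₁ bd) (norm_jetRead_apply_le (H₁ Bt) bd)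
      _ ≤ 3 * B₀ * ρ + 2 * B₀ * ρ := add_le_add hA₁size.le h𝔄'
      _ = 5 * B₀ * ρ := by ring
  have hnY : 5 * B₀ * ρ ≤ 10 * B₀ / 2 * ρ := by linarith
  have hx : ∀ bd, ‖(toL2 F K c₀).symm x bd‖ ≤ (1 + 25 * C₄ * B₀ ^ 2) * ρ := by
    intro bd
    rw [hxdef, toL2_symm_funEquiv_symm_apply, Pi.add_apply]
    calc ‖NegSup.equiv _ _ (Jcur (bgOfCfg F K U₀)) (bondEquiv F K bd) + NegSup.equiv _ _ (W (A₁ + H₁ Bt)) (bondEquiv F K bd)‖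
        ≤ ‖NegSup.equiv _ _ (Jcur (bgOfCfg F K U₀)) (bondEquiv F K bd)‖ + ‖NegSup.equiv _ _ (W (A₁ + H₁ Bt)) (bondEquiv F K bd)‖ := norm_add_le _ _
      _ ≤ ‖Jcur (L := (F.L : ℝ)) (η := ((F.L : ℝ)⁻¹) ^ (K - n)) (lev₀ := fun _ : Bond 3 (periodsT3 F K) => K - n) (bgOfCfg F K U₀)‖ + ‖W (A₁ + H₁ Bt)‖ :=
          add_le_add (norm_negSup_equiv_apply_le _ _) (norm_negSup_equiv_apply_le _ _)
      _ ≤ ρ + 25 * C₄ * B₀ ^ 2 * ρ := add_le_add hJ hW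
      _ = (1 + 25 * C₄ * B₀ ^ 2) * ρ := by ring
  -- the `L²` reading of (111) AT THE LETTERS' SLOT `ΔL`: `toL2 Yf = −𝔊_L(Ĵ + Ŵ) + H_L(toL2B B̃)` (✓`toL2_iota_eq111`), whence the solution's slice rows
  -- `hLan`∕`hQY` are THEOREMS from the class and the two Landau guards of `ΔL` (✓`RS_DstarL2_sol`, ✓`Qk_sol` — print's (109)∕(102): `R D*A₁ = 0`, `QA₁ = 0`, `RD*H₁ = 0`, `QH₁B = B`)
  have hY : toL2 F K c₀ Yf = -(frakGT F n K h c₀ cB a ΔL U₀ x) + HT F n K h c₀ cB a ΔL U₀ (toL2B F n cB Bt) := by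
    rw [hYfdef, Prop7Size19Orders01.iota_add F n K U₀ A₁ (H₁ Bt), hH₁def]
    exact toL2_iota_eq111 (Δx := ΔL) U₀ A₁ _ _ Bt heq
  have hLan : RS F n K h c₀ cB U₀ (DstarL2 F n K c₀ U₀ (toL2 F K c₀ Yf)) = 0 := by
    rw [hY]; exact RS_DstarL2_sol hpL hkillL horthL x (toL2B F n cB Bt)
  have hQY : Qk F n K h c₀ cB U₀ (toL2 F K c₀ Yf) = toL2B F n cB Bt := by
    rw [hY]; exact Qk_sol hpL hkillL x (toL2B F n cB Bt)
  -- ONE call to ★px5's slot-generic (127)+(128) junction AT THE OPERATOR SLOT `Δx` (slice rows + (128) of the solution; no operator guard on `Δx`, no multiplier) with the four operator rows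
  have hb' : ∀ c : PBond (F.P n) 0, ‖Bt c‖ ≤ 2 * ρ := fun c => (norm_le_pi_norm Bt c).trans hBt'
  have hmain := secondOrder_of_eq128_opRowsEta_rho (cx := 1 + 25 * C₄ * B₀ ^ 2) (cb := 2) (B₁ := 10 * B₀) hρ.le hρ1 hreg hp x Bt μ Yf hLan hQY h128
    hYsup hnY hx le_rfl hb' le_rfl hOpC h137 hOp139 hOp349
  simpa only [hYfdef, hH₁def, hBtdef] using hmain

end Summit.QuantumFields.YangMills.Theorems.Prop7HDsolAtRecordOfRowsTwoSlot

end
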